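import Literature.Analysis.FunctionSpaces.TorusPatching
import Literature.Analysis.FunctionSpaces.TorusCalculus
import HarnessLib

/-!
# Smooth gluing of patched blocks (Alberti–Crippa–Mazzucato 2019, §6.3 and §8.6)

Topic `Literature/Analysis/FunctionSpaces`; companion of `TorusPatching.lean`. The patching
operator `Torus.patch m ι G` (Bruè–De Lellis 2023, (4.3); Alberti–Crippa–Mazzucato 2019,
(6.2)–(6.3)) places on every cell `Q_κ` of the tiling of mesh `m⁻¹` the rescaled block
`G_{ι κ}(m y - κ)`. Smoothness of the result across the interfaces is *not* automatic: it is
Assumption 6.3 of ACM ("regularity of the patching"), verified for the Peano snake in ACM §8.6 by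
the observation that two blocks placed on adjacent squares *coincide, as functions, on a
neighbourhood of the common side* (there: both agree near the midpoint of the side with the field
generated by a straight line, Lemma 25, and both vanish near the rest of the side).

This file proves the abstract gluing statement behind that argument, for time-dependent blocks
`G_l : ℝ → ℝ^d → X` jointly `Cⁿ` in `(t, z)`:

* `Torus.contDiff_uncurry_patch_of_compatible`: if for every cell index `κ` and every
  "lower-neighbour offset" `e ∈ {0,1}^d` the blocks of the cells `κ` and `κ - e` satisfy
  `G_{ι κ}(t, z) = G_{ι(κ-e)}(t, z + e)` whenever `|zᵢ| < δ` for the directions `i` with `eᵢ = 1`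
  (agreement, after the translation identifying the two local charts, on a `δ`-strip around the
  common face / edge / corner), then `(t, y) ↦ patch m ι (G · t) y` is `Cⁿ` on `ℝ × ℝ^d`;
* `Torus.isSmoothSpaceTimeOn_patchTorus_of_compatible`: the same for the torus patch
  `patchTorus` (labels read modulo `m`, `Torus.lift_patchTorus`), in the accepted space–time
  smoothness class `Torus.IsSmoothSpaceTimeOn`.

The point of the half-open cells `[κ/m, (κ+1)/m)` is that a point `y₀ ∈ Q_{κ₀}` is approached
only from the cells `Q_{κ₀ - e}`, `e ∈ {0,1}^d`, so only these `2^d - 1` compatibilities are needed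
around `y₀`, and near `y₀` the patched function *is* the smooth function
`(t, y) ↦ G_{ι κ₀}(t, m y - κ₀)`.

## References

* G. Alberti, G. Crippa, A. L. Mazzucato, *Exponential self-similar mixing by incompressible
  flows*, J. Amer. Math. Soc. 32 (2019), 445–490, §6.2–6.3 (Assumption 6.3, Remark 17 (iii)),
  §8.6 (arXiv:1605.02090, pp. 19, 26–27).
* E. Bruè, C. De Lellis, *Anomalous dissipation for the forced 3D Navier–Stokes equations*,
  Comm. Math. Phys. 400 (2023), §4, (4.3)–(4.4), Thm. 4.1 ("a family of smooth solutions").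
-/

noncomputable section

open Set Filter Function

open scoped Topology ContDiff

namespace Literature.Analysis.FunctionSpaces

namespace Torus

variable {d : Type*} [Fintype d] [DecidableEq d] {I : Type*}
  {X : Type*} [NormedAddCommGroup X] [NormedSpace ℝ X]

/-- **Local compatibility of blocks** placed by the labels `ι` on the cells of mesh `m⁻¹`
(Alberti–Crippa–Mazzucato 2019, §8.6: adjacent blocks coincide near the common side): for every
cell index `κ` and every offset `e ∈ {0,1}^d`, the block of the cell `κ` and the block of the
lower neighbour `κ - e`, compared in the local chart of `κ` (the chart of `κ - e` is the translate
by `e`), agree at all times on the `δ`-strip `{z | |zᵢ| < δ whenever eᵢ = 1}` around the common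
face (`e` a unit vector), edge, …, corner (`e = (1,…,1)`). For `e = 0` the condition is void.
[cite: AlbertiCrippaMazzucato2019, §8.6] -/
def PatchCompatible (ι : (d → ℤ) → I) (G : I → ℝ → EuclideanSpace ℝ d → X) (δ : ℝ) : Prop :=
  ∀ (κ e : d → ℤ), (∀ i, e i = 0 ∨ e i = 1) → ∀ (t : ℝ) (z : EuclideanSpace ℝ d),
    (∀ i, e i = 1 → |z i| < δ) → G (ι κ) t z = G (ι (κ - e)) t (z + latticeVec e)

omit [NormedAddCommGroup X] [NormedSpace ℝ X] in
/-- Unfolding `PatchCompatible`. [folklore] -/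
theorem patchCompatible_iff {ι : (d → ℤ) → I} {G : I → ℝ → EuclideanSpace ℝ d → X} {δ : ℝ} :
    PatchCompatible ι G δ ↔
      ∀ (κ e : d → ℤ), (∀ i, e i = 0 ∨ e i = 1) → ∀ (t : ℝ) (z : EuclideanSpace ℝ d),
        (∀ i, e i = 1 → |z i| < δ) → G (ι κ) t z = G (ι (κ - e)) t (z + latticeVec e) :=
  Iff.rfl

variable {m : ℕ} {ι : (d → ℤ) → I} {G : I → ℝ → EuclideanSpace ℝ d → X} {δ : ℝ}

omit [NormedAddCommGroup X] [NormedSpace ℝ X] in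
/-- **The patched function near a point is one rescaled block.** Under `PatchCompatible ι G δ`
(`δ > 0`, `m ≥ 1`), around every `(t₀, y₀)`, `y₀ ∈ Q_{κ₀}`, the space–time patched function
`(t, y) ↦ patch m ι (G · t) y` coincides with `(t, y) ↦ G_{ι κ₀}(t, m y - κ₀)`. [folklore] -/
theorem patch_eventuallyEq_block_of_compatible (hm : 0 < m) (hδ : 0 < δ)
    (hc : PatchCompatible ι G δ) (t₀ : ℝ) (y₀ : EuclideanSpace ℝ d) :
    (fun p : ℝ × EuclideanSpace ℝ d => patch m ι (fun l => G l p.1) p.2) =ᶠ[𝓝 (t₀, y₀)]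
      fun p => G (ι (cellIndex m y₀)) p.1 ((m : ℝ) • p.2 - latticeVec (cellIndex m y₀)) := by
  set κ₀ := cellIndex m y₀ with hκ₀
  have hm' : (0 : ℝ) < m := by exact_mod_cast hm
  set δ' : ℝ := min δ 1 with hδ'
  have hδ'pos : 0 < δ' := lt_min hδ one_pos
  have hδ'le : δ' ≤ δ := min_le_left _ _
  have hδ'le1 : δ' ≤ 1 := min_le_right _ _
  have hy₀ := mem_latticeCell_cellIndex hm y₀
  -- the two open conditions, coordinatewise, valid at `y₀`
  have hcont : ∀ i, Continuous fun p : ℝ × EuclideanSpace ℝ d => (m : ℝ) * p.2 i := fun i =>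
    continuous_const.mul ((PiLp.continuous_apply 2 (fun _ : d => ℝ) i).comp continuous_snd)
  have hev : ∀ᶠ p : ℝ × EuclideanSpace ℝ d in 𝓝 (t₀, y₀),
      ∀ i, (m : ℝ) * p.2 i < κ₀ i + 1 ∧ (κ₀ i : ℝ) - δ' < (m : ℝ) * p.2 i := by
    refine eventually_all.2 fun i => ?_
    have h1 : (m : ℝ) * y₀ i < κ₀ i + 1 := by
      have := (hy₀ i).2
      rw [lt_div_iff₀ hm'] at this
      linarith
    have h2 : (κ₀ i : ℝ) - δ' < (m : ℝ) * y₀ i := by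
      have := (hy₀ i).1
      rw [div_le_iff₀ hm'] at this
      linarith
    exact ((hcont i).continuousAt.eventually_lt continuousAt_const h1).and
      (continuousAt_const.eventually_lt (hcont i).continuousAt h2)
  filter_upwards [hev] with p hp
  obtain ⟨t, y⟩ := p
  set κ := cellIndex m y with hκ
  -- the offset `e = κ₀ - κ` lies in `{0,1}^d`
  set e : d → ℤ := κ₀ - κ with he
  have hκi : ∀ i, κ i = ⌊(m : ℝ) * y i⌋ := fun i => rfl
  have he01 : ∀ i, e i = 0 ∨ e i = 1 := by
    intro i
    obtain ⟨ha, hb⟩ := hp i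
    have hle : κ i ≤ κ₀ i := by
      rw [hκi, Int.floor_le_iff]; exact_mod_cast ha
    have hge : κ₀ i - 1 ≤ κ i := by
      rw [hκi, Int.le_floor]; push_cast; linarith
    have : e i = κ₀ i - κ i := rfl
    omega
  have hstrip : ∀ i, e i = 1 → |((m : ℝ) • y - latticeVec κ₀) i| < δ := by
    intro i hi
    obtain ⟨ha, hb⟩ := hp i
    have hki : κ i = κ₀ i - 1 := by have : e i = κ₀ i - κ i := rfl; omega
    have hlt : (m : ℝ) * y i < κ₀ i := by
      have := Int.lt_floor_add_one ((m : ℝ) * y i)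
      rw [← hκi, hki] at this
      push_cast at this
      linarith
    rw [PiLp.sub_apply, PiLp.smul_apply, smul_eq_mul, latticeVec_apply, abs_lt]
    constructor <;> linarith
  have hκe : κ₀ - e = κ := by simp [he]
  have key := hc κ₀ e he01 t ((m : ℝ) • y - latticeVec κ₀) hstrip
  rw [hκe] at key
  have hvec : (m : ℝ) • y - latticeVec κ₀ + latticeVec e = (m : ℝ) • y - latticeVec κ := by
    rw [← hκe]
    ext i
    simp only [PiLp.add_apply, PiLp.sub_apply, latticeVec_apply, Pi.sub_apply, Int.cast_sub]
    ring
  rw [hvec] at key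
  -- `patch` at `(t, y)` is the block of the cell `κ`
  show patch m ι (fun l => G l t) y = G (ι κ₀) t ((m : ℝ) • y - latticeVec κ₀)
  rw [key, patch_apply]
  rfl

/-- **Smooth gluing of patched blocks** (Alberti–Crippa–Mazzucato 2019, §6.3 with §8.6): if the
blocks `G_l(t, z)` are jointly `Cⁿ` and locally compatible across the interfaces
(`PatchCompatible ι G δ`, `δ > 0`), the patched space–time function
`(t, y) ↦ patch m ι (G · t) y` is `Cⁿ` on `ℝ × ℝ^d` (`m ≥ 1`). [cite: AlbertiCrippaMazzucato2019, §6.3 and §8.6] -/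
theorem contDiff_uncurry_patch_of_compatible (hm : 0 < m) {n : WithTop ℕ∞}
    (hG : ∀ l, ContDiff ℝ n (uncurry (G l))) (hδ : 0 < δ) (hc : PatchCompatible ι G δ) :
    ContDiff ℝ n fun p : ℝ × EuclideanSpace ℝ d => patch m ι (fun l => G l p.1) p.2 := by
  refine contDiff_iff_contDiffAt.2 fun p₀ => ?_
  obtain ⟨t₀, y₀⟩ := p₀
  have hblock : ContDiff ℝ n fun p : ℝ × EuclideanSpace ℝ d =>
      G (ι (cellIndex m y₀)) p.1 ((m : ℝ) • p.2 - latticeVec (cellIndex m y₀)) :=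
    (hG _).comp (contDiff_fst.prodMk ((contDiff_snd.const_smul (m : ℝ)).sub contDiff_const))
  exact hblock.contDiffAt.congr_of_eventuallyEq
    (patch_eventuallyEq_block_of_compatible hm hδ hc t₀ y₀)

/-- Time slices of the glued patch are `Cⁿ` in space. [folklore] -/
theorem contDiff_patch_of_compatible (hm : 0 < m) {n : WithTop ℕ∞}
    (hG : ∀ l, ContDiff ℝ n (uncurry (G l))) (hδ : 0 < δ) (hc : PatchCompatible ι G δ) (t : ℝ) :
    ContDiff ℝ n (patch m ι fun l => G l t) :=
  (contDiff_uncurry_patch_of_compatible hm hG hδ hc).comp (contDiff_prodMk_right t)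

/-- **Smooth gluing on the torus** (Bruè–De Lellis 2023, Thm. 4.1: the patched family (4.3)–(4.4)
"of smooth solutions"; ACM 2019, §8.6–8.8): if the blocks are jointly `C^∞` and the labels read
modulo `m` are locally compatible (`PatchCompatible (ι ∘ (· mod m)) G δ`), the patched torus
fields `t ↦ patchTorus m ι (G · t)` are jointly smooth on `S × T^d` for every time set `S`
(`Torus.IsSmoothSpaceTimeOn`; the lift of the torus patch is the planar patch with labels mod
`m`, `Torus.lift_patchTorus`). [cite: BrueDeLellisCMP2023, Thm. 4.1] -/
theorem isSmoothSpaceTimeOn_patchTorus_of_compatible (hm : 0 < m)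
    (hG : ∀ l, ContDiff ℝ ∞ (uncurry (G l))) (hδ : 0 < δ)
    (hc : PatchCompatible (fun κ : d → ℤ => ι fun i => κ i % m) G δ) (S : Set ℝ) :
    IsSmoothSpaceTimeOn S fun t => patchTorus m ι fun l => G l t := by
  unfold IsSmoothSpaceTimeOn
  have heq : stLift (fun t => patchTorus m ι fun l => G l t) =
      fun p : ℝ × EuclideanSpace ℝ d => patch m (fun κ : d → ℤ => ι fun i => κ i % m)
        (fun l => G l p.1) p.2 := by
    funext p
    rw [stLift_apply, ← lift_apply (patchTorus m ι fun l => G l p.1) p.2, lift_patchTorus hm]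
  rw [heq]
  exact (contDiff_uncurry_patch_of_compatible hm hG hδ hc).contDiffOn

end Torus

end Literature.Analysis.FunctionSpaces

end
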